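import Mathlib.MeasureTheory.Integral.Marginal
import Mathlib.MeasureTheory.Integral.Pi
import Mathlib.Analysis.SpecialFunctions.Gaussian.GaussianIntegral
import Literature.MathematicalPhysics.KineticTheory.InfiniteChainSeveredGibbs
import HarnessLib

/-!
# The finite-volume Gibbs distributions of the chain as marginal integrals

Topic `Literature/MathematicalPhysics/KineticTheory`; theorems only (no definitions, no named
facts), about the Gibbsian specification `OscillatorChain.chainSpecification P T` of the infinite
oscillator chain (`InfiniteChainDynamics.lean`; LLL 1977 (14), built with
`Literature.Probability.LatticeModels.gibbsSpecOfPotential`, a priori measure Lebesgue on `ℝ × ℝ`,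
Mathlib `Measure.tilted`).

* `lintegral_map_glueWith_pi_eq_lmarginal` — the a priori measure `(dq dp)^{⊗Λ} ⊗ δ_{η off Λ}` of
  the kernel integrates a function `F` to Mathlib's marginal integral `(∫⋯∫⁻_Λ, F) η`
  (`MeasureTheory.lmarginal`; `glueWith = Function.updateFinset`);
* `chainSpecification_apply_eq_lmarginal_div` — **the kernels as ratios of marginal integrals**:
  for measurable `U`, `V` and every `T`, `Λ`, `η` and measurable `A`,
  `γ_Λ(A | η) = (∫⋯∫⁻_Λ 𝟙_A e^{-H_Λ/T})(η) / (∫⋯∫⁻_Λ e^{-H_Λ/T})(η)` — valid without any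
  normalisability hypothesis (when `Z_Λ(η) = ∞` both sides vanish, Mathlib's junk value of
  `Measure.tilted` matching `x / ∞ = 0` in `ℝ≥0∞`); `lintegral_chainSpecification_eq_lmarginal_div`
  — the same for `ℝ≥0∞`-valued observables when the normaliser is finite;
* `lmarginal_boltzmann_lt_top`, `lmarginal_boltzmann_pos` — for `T > 0`, `V ≥ 0`, `U` measurable
  with `∫ e^{-U(q)/T} dq < ∞`: `0 < (∫⋯∫⁻_Λ e^{-H_Λ/T})(η) < ∞` for every `η` (drop the
  non-negative interaction; Gaussian momenta);
* `integrable_exp_neg_pinning` — `∫ e^{-(ω₂ q²/2 + lam q⁴/4)/T} dq < ∞` (`T, ω₂ > 0`, `lam ≥ 0`),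
  the integrability making the one-site a priori measure `e^{-U/T} dq` of the pinned chain finite.

These are inputs of the existence proof of infinite-volume Gibbs states of the chain (transfer
operator; DLR verification on windows as identities between marginal integrals). LLL's condition
B2 itself (normalisability, `P.CondB2 T`) is `condB2_of_integrable_exp_neg` /
`condB2_pinnedChain` of `InfiniteChainGibbsNormalisable.lean`; the finiteness statement here is its
`lmarginal` form.

## References

* O. E. Lanford, J. L. Lebowitz, E. H. Lieb, J. Stat. Phys. 16 (1977) 453–461, §4 (14),
  condition B2. [LanfordLebowitzLieb1977]
* H.-O. Georgii, *Gibbs Measures and Phase Transitions* (2011), Def. 2.9 (Gibbsian specifications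
  as normalised Boltzmann weights). [Georgii2011]
-/

noncomputable section

open MeasureTheory Filter Set Function Literature.Probability.LatticeModels
open scoped ENNReal

namespace Literature.MathematicalPhysics.KineticTheory.HeatConduction

namespace OscillatorChain

variable (P : OscillatorChain)

/-! ### Measurability of the finite-volume Hamiltonian -/

/-- The finite-volume Hamiltonian `H_Λ` (LLL (10)) is measurable when `U`, `V` are. [folklore] -/
theorem measurable_hamiltonianIn_chain (hU : Measurable P.U) (hV : Measurable P.V) (Λ : Finset ℤ) :
    Measurable fun σ : ChainConfig => hamiltonianIn P.chainPotential chainSupp Λ σ := by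
  have hq : ∀ i : ℤ, Measurable fun σ : ChainConfig => (σ i).1 := fun i =>
    measurable_fst.comp (measurable_pi_apply i)
  have hp : ∀ i : ℤ, Measurable fun σ : ChainConfig => (σ i).2 := fun i =>
    measurable_snd.comp (measurable_pi_apply i)
  simp only [hamiltonianIn_chain]
  refine (Finset.measurable_sum _ fun x _ => ?_).add (Finset.measurable_sum _ fun y _ => ?_)
  · exact (((hp x).pow_const 2).div_const 2).add (hU.comp (hq x))
  · exact hV.comp ((hq (y + 1)).sub (hq y))

/-- The Boltzmann weight `e^{-H_Λ/T}` (as an `ℝ≥0∞`-valued function) is measurable. [folklore] -/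
theorem measurable_boltzmannWeight (hU : Measurable P.U) (hV : Measurable P.V) (T : ℝ)
    (Λ : Finset ℤ) :
    Measurable fun σ : ChainConfig =>
      ENNReal.ofReal (Real.exp (-T⁻¹ * hamiltonianIn P.chainPotential chainSupp Λ σ)) :=
  ENNReal.measurable_ofReal.comp
    (Real.measurable_exp.comp ((P.measurable_hamiltonianIn_chain hU hV Λ).const_mul _))

/-! ### The a priori measure of the kernel as a marginal integral -/

omit P in
/-- **The a priori measure `(dq dp)^{⊗Λ} ⊗ δ_η` integrates to the marginal integral over `Λ`**:
`∫ F d((Leb^{⊗Λ}) ∘ glueWith(·, η)⁻¹) = (∫⋯∫⁻_Λ F)(η)` (Mathlib `lmarginal`; `glueWith Λ ζ η` is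
`Function.updateFinset η Λ ζ`). [folklore] -/
theorem lintegral_map_glueWith_pi_eq_lmarginal (Λ : Finset ℤ) (η : ChainConfig)
    {F : ChainConfig → ℝ≥0∞} (hF : Measurable F) :
    ∫⁻ σ, F σ ∂(Measure.pi fun _ : Λ => (volume : Measure (ℝ × ℝ))).map (glueWith Λ · η) =
      (∫⋯∫⁻_Λ, F ∂fun _ : ℤ => (volume : Measure (ℝ × ℝ))) η := by
  rw [lintegral_map hF (measurable_glueWith Λ η)]
  simp only [glueWith_eq_updateFinset]
  rfl

omit P in
/-- Bochner version: `∫ g d((Leb^{⊗Λ}) ∘ glueWith(·, η)⁻¹) = ∫ g(ζ ∨ η) dζ`. [folklore] -/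
theorem integral_map_glueWith_pi (Λ : Finset ℤ) (η : ChainConfig) {g : ChainConfig → ℝ}
    (hg : Measurable g) :
    ∫ σ, g σ ∂(Measure.pi fun _ : Λ => (volume : Measure (ℝ × ℝ))).map (glueWith Λ · η) =
      ∫ ζ, g (glueWith Λ ζ η) ∂(Measure.pi fun _ : Λ => (volume : Measure (ℝ × ℝ))) :=
  integral_map (measurable_glueWith Λ η).aemeasurable hg.aestronglyMeasurable

omit P in
/-- Marginal integrals commute with multiplication by a constant on the right. [folklore] -/
theorem lmarginal_mul_const (Λ : Finset ℤ) {F : ChainConfig → ℝ≥0∞} (hF : Measurable F)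
    (c : ℝ≥0∞) (η : ChainConfig) :
    (∫⋯∫⁻_Λ, (fun σ => F σ * c) ∂fun _ : ℤ => (volume : Measure (ℝ × ℝ))) η =
      (∫⋯∫⁻_Λ, F ∂fun _ : ℤ => (volume : Measure (ℝ × ℝ))) η * c := by
  unfold lmarginal
  exact lintegral_mul_const c (hF.comp measurable_updateFinset)

omit P in
/-- The a priori measure `(dq dp)^{⊗Λ} ⊗ δ_η` is not the zero measure. [folklore] -/
theorem map_glueWith_pi_univ_ne_zero (Λ : Finset ℤ) (η : ChainConfig) :
    NeZero ((Measure.pi fun _ : Λ => (volume : Measure (ℝ × ℝ))).map (glueWith Λ · η)) := by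
  refine ⟨fun h0 => ?_⟩
  have h1 : ((Measure.pi fun _ : Λ => (volume : Measure (ℝ × ℝ))).map (glueWith Λ · η)) univ = 0 := by
    rw [h0]; rfl
  rw [Measure.map_apply (measurable_glueWith Λ η) MeasurableSet.univ, preimage_univ,
    Measure.pi_univ] at h1
  simp at h1

/-! ### The kernels as ratios of marginal integrals -/

/-- **The finite-volume Gibbs distributions of the chain as ratios of marginal integrals.** For
measurable `U`, `V`, every `T`, every finite `Λ ⊆ ℤ`, every boundary condition `η` and every
measurable `A`:
`γ_Λ(A | η) = (∫⋯∫⁻_Λ 𝟙_A e^{-H_Λ/T})(η) / (∫⋯∫⁻_Λ e^{-H_Λ/T})(η)`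
(Georgii 2011, Def. 2.9: `γ_Λ(A | η) = Z_Λ(η)⁻¹ ∫ 𝟙_A(ζ η_{Λᶜ}) e^{-β H_Λ(ζ η_{Λᶜ})} dζ`; LLL 1977
(14)). No normalisability is assumed: if `Z_Λ(η) = ∞` the kernel is Mathlib's junk `0` and the
right-hand side is `· / ∞ = 0` as well. [cite: Georgii2011, Def. 2.9] -/
theorem chainSpecification_apply_eq_lmarginal_div (hU : Measurable P.U) (hV : Measurable P.V)
    (T : ℝ) (Λ : Finset ℤ) (η : ChainConfig) {A : Set ChainConfig} (hA : MeasurableSet A) :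
    P.chainSpecification T Λ η A =
      (∫⋯∫⁻_Λ, (fun σ => A.indicator 1 σ *
          ENNReal.ofReal (Real.exp (-T⁻¹ * hamiltonianIn P.chainPotential chainSupp Λ σ)))
        ∂fun _ : ℤ => (volume : Measure (ℝ × ℝ))) η /
      (∫⋯∫⁻_Λ, (fun σ =>
          ENNReal.ofReal (Real.exp (-T⁻¹ * hamiltonianIn P.chainPotential chainSupp Λ σ)))
        ∂fun _ : ℤ => (volume : Measure (ℝ × ℝ))) η := by
  -- notation
  set m : Measure ChainConfig :=
    (Measure.pi fun _ : Λ => (volume : Measure (ℝ × ℝ))).map (glueWith Λ · η) with hm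
  set f : ChainConfig → ℝ := fun σ => -T⁻¹ * hamiltonianIn P.chainPotential chainSupp Λ σ with hf
  set w : ChainConfig → ℝ≥0∞ := fun σ => ENNReal.ofReal (Real.exp (f σ)) with hw
  have hfm : Measurable f := (P.measurable_hamiltonianIn_chain hU hV Λ).const_mul _
  have hwm : Measurable w := P.measurable_boltzmannWeight hU hV T Λ
  have hexpm : Measurable fun σ => Real.exp (f σ) := Real.measurable_exp.comp hfm
  haveI : NeZero m := map_glueWith_pi_univ_ne_zero Λ η
  change m.tilted f A = (∫⋯∫⁻_Λ, (fun σ => A.indicator 1 σ * w σ)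
      ∂fun _ : ℤ => (volume : Measure (ℝ × ℝ))) η /
    (∫⋯∫⁻_Λ, w ∂fun _ : ℤ => (volume : Measure (ℝ × ℝ))) η
  -- the normaliser and the numerator as integrals against `m`
  have hZ : (∫⋯∫⁻_Λ, w ∂fun _ : ℤ => (volume : Measure (ℝ × ℝ))) η =
      ∫⁻ σ, ENNReal.ofReal (Real.exp (f σ)) ∂m :=
    (lintegral_map_glueWith_pi_eq_lmarginal Λ η hwm).symm
  have hnum : (∫⋯∫⁻_Λ, (fun σ => A.indicator 1 σ * w σ)
      ∂fun _ : ℤ => (volume : Measure (ℝ × ℝ))) η = ∫⁻ σ, A.indicator 1 σ * w σ ∂m :=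
    (lintegral_map_glueWith_pi_eq_lmarginal Λ η ((measurable_one.indicator hA).mul hwm)).symm
  rw [hZ, hnum]
  by_cases hint : Integrable (fun σ => Real.exp (f σ)) m
  · -- normalisable case
    have hZpos : 0 < ∫ σ, Real.exp (f σ) ∂m := integral_exp_pos hint
    have hZeq : ENNReal.ofReal (∫ σ, Real.exp (f σ) ∂m) =
        ∫⁻ σ, ENNReal.ofReal (Real.exp (f σ)) ∂m :=
      ofReal_integral_eq_lintegral_ofReal hint (Eventually.of_forall fun σ => (Real.exp_pos _).le)
    rw [tilted_apply' _ _ hA, ← lintegral_indicator hA]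
    have hind : ∀ σ, A.indicator (fun σ => ENNReal.ofReal
        (Real.exp (f σ) / ∫ x, Real.exp (f x) ∂m)) σ =
        A.indicator 1 σ * w σ * (ENNReal.ofReal (∫ x, Real.exp (f x) ∂m))⁻¹ := by
      intro σ
      by_cases hσ : σ ∈ A
      · rw [indicator_of_mem hσ, indicator_of_mem hσ, Pi.one_apply, one_mul,
          ENNReal.ofReal_div_of_pos hZpos, div_eq_mul_inv]
      · rw [indicator_of_notMem hσ, indicator_of_notMem hσ, zero_mul, zero_mul]
    simp_rw [hind]
    have hinv : (ENNReal.ofReal (∫ x, Real.exp (f x) ∂m))⁻¹ ≠ ∞ :=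
      ENNReal.inv_ne_top.2 (ENNReal.ofReal_pos.2 hZpos).ne'
    rw [lintegral_mul_const' _ _ hinv, hZeq, div_eq_mul_inv]
  · -- non-normalisable case: both sides vanish
    have htilt : m.tilted f = 0 := tilted_of_not_integrable hint
    have htop : ∫⁻ σ, ENNReal.ofReal (Real.exp (f σ)) ∂m = ∞ := by
      by_contra hne
      apply hint
      refine ⟨hexpm.aestronglyMeasurable, ?_⟩
      rw [hasFiniteIntegral_iff_ofReal (Eventually.of_forall fun σ => (Real.exp_pos _).le)]
      exact lt_top_iff_ne_top.2 hne
    rw [htilt, htop, ENNReal.div_top]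
    rfl

/-- **The kernels as ratios of marginal integrals, for `ℝ≥0∞`-valued observables**: for measurable
`F ≥ 0`, `∫ F dγ_Λ(· | η) = (∫⋯∫⁻_Λ F e^{-H_Λ/T})(η) / (∫⋯∫⁻_Λ e^{-H_Λ/T})(η)` whenever the
normaliser `(∫⋯∫⁻_Λ e^{-H_Λ/T})(η)` is finite (Georgii 2011, Def. 2.9). [cite: Georgii2011, Def. 2.9] -/
theorem lintegral_chainSpecification_eq_lmarginal_div (hU : Measurable P.U) (hV : Measurable P.V)
    (T : ℝ) (Λ : Finset ℤ) (η : ChainConfig)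
    (hZ : (∫⋯∫⁻_Λ, (fun σ =>
          ENNReal.ofReal (Real.exp (-T⁻¹ * hamiltonianIn P.chainPotential chainSupp Λ σ)))
        ∂fun _ : ℤ => (volume : Measure (ℝ × ℝ))) η ≠ ∞)
    {F : ChainConfig → ℝ≥0∞} (hF : Measurable F) :
    ∫⁻ σ, F σ ∂(P.chainSpecification T Λ η) =
      (∫⋯∫⁻_Λ, (fun σ => F σ *
          ENNReal.ofReal (Real.exp (-T⁻¹ * hamiltonianIn P.chainPotential chainSupp Λ σ)))
        ∂fun _ : ℤ => (volume : Measure (ℝ × ℝ))) η /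
      (∫⋯∫⁻_Λ, (fun σ =>
          ENNReal.ofReal (Real.exp (-T⁻¹ * hamiltonianIn P.chainPotential chainSupp Λ σ)))
        ∂fun _ : ℤ => (volume : Measure (ℝ × ℝ))) η := by
  set m : Measure ChainConfig :=
    (Measure.pi fun _ : Λ => (volume : Measure (ℝ × ℝ))).map (glueWith Λ · η) with hm
  set f : ChainConfig → ℝ := fun σ => -T⁻¹ * hamiltonianIn P.chainPotential chainSupp Λ σ with hf
  set w : ChainConfig → ℝ≥0∞ := fun σ => ENNReal.ofReal (Real.exp (f σ)) with hw
  have hfm : Measurable f := (P.measurable_hamiltonianIn_chain hU hV Λ).const_mul _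
  have hwm : Measurable w := P.measurable_boltzmannWeight hU hV T Λ
  have hexpm : Measurable fun σ => Real.exp (f σ) := Real.measurable_exp.comp hfm
  haveI : NeZero m := map_glueWith_pi_univ_ne_zero Λ η
  change ∫⁻ σ, F σ ∂(m.tilted f) = (∫⋯∫⁻_Λ, (fun σ => F σ * w σ)
      ∂fun _ : ℤ => (volume : Measure (ℝ × ℝ))) η /
    (∫⋯∫⁻_Λ, w ∂fun _ : ℤ => (volume : Measure (ℝ × ℝ))) η
  have hZ' : (∫⋯∫⁻_Λ, w ∂fun _ : ℤ => (volume : Measure (ℝ × ℝ))) η =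
      ∫⁻ σ, ENNReal.ofReal (Real.exp (f σ)) ∂m :=
    (lintegral_map_glueWith_pi_eq_lmarginal Λ η hwm).symm
  have hnum : (∫⋯∫⁻_Λ, (fun σ => F σ * w σ) ∂fun _ : ℤ => (volume : Measure (ℝ × ℝ))) η
      = ∫⁻ σ, F σ * w σ ∂m :=
    (lintegral_map_glueWith_pi_eq_lmarginal Λ η (hF.mul hwm)).symm
  have hZtop : ∫⁻ σ, ENNReal.ofReal (Real.exp (f σ)) ∂m ≠ ∞ := by rwa [← hZ']
  have hint : Integrable (fun σ => Real.exp (f σ)) m := by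
    refine ⟨hexpm.aestronglyMeasurable, ?_⟩
    rw [hasFiniteIntegral_iff_ofReal (Eventually.of_forall fun σ => (Real.exp_pos _).le)]
    exact lt_top_iff_ne_top.2 hZtop
  have hZpos : 0 < ∫ σ, Real.exp (f σ) ∂m := integral_exp_pos hint
  have hZeq : ENNReal.ofReal (∫ σ, Real.exp (f σ) ∂m) =
      ∫⁻ σ, ENNReal.ofReal (Real.exp (f σ)) ∂m :=
    ofReal_integral_eq_lintegral_ofReal hint (Eventually.of_forall fun σ => (Real.exp_pos _).le)
  rw [hZ', hnum, lintegral_tilted]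
  have hpt : ∀ σ, ENNReal.ofReal (Real.exp (f σ) / ∫ x, Real.exp (f x) ∂m) * F σ =
      F σ * w σ * (ENNReal.ofReal (∫ x, Real.exp (f x) ∂m))⁻¹ := by
    intro σ
    rw [ENNReal.ofReal_div_of_pos hZpos, div_eq_mul_inv]
    ring
  simp_rw [hpt]
  have hinv : (ENNReal.ofReal (∫ x, Real.exp (f x) ∂m))⁻¹ ≠ ∞ :=
    ENNReal.inv_ne_top.2 (ENNReal.ofReal_pos.2 hZpos).ne'
  rw [lintegral_mul_const' _ _ hinv, hZeq, div_eq_mul_inv]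

/-! ### Finiteness and positivity of the normaliser -/

/-- Dropping the non-negative interaction: `e^{-H_Λ(σ)/T} ≤ ∏_{x ∈ Λ} e^{-(p_x²/2 + U(q_x))/T}` for
`T > 0` and `V ≥ 0`. [folklore] -/
theorem boltzmannWeight_le_prod {T : ℝ} (hT : 0 < T) (hV0 : ∀ r, 0 ≤ P.V r) (Λ : Finset ℤ)
    (σ : ChainConfig) :
    ENNReal.ofReal (Real.exp (-T⁻¹ * hamiltonianIn P.chainPotential chainSupp Λ σ)) ≤
      ∏ x ∈ Λ, ENNReal.ofReal (Real.exp (-T⁻¹ * ((σ x).2 ^ 2 / 2 + P.U (σ x).1))) := by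
  rw [← ENNReal.ofReal_prod_of_nonneg fun x _ => (Real.exp_pos _).le, ← Real.exp_sum,
    ← Finset.mul_sum]
  refine ENNReal.ofReal_le_ofReal (Real.exp_le_exp.2 ?_)
  rw [hamiltonianIn_chain]
  have hVs : 0 ≤ ∑ y ∈ bondSet Λ, P.V ((σ (y + 1)).1 - (σ y).1) :=
    Finset.sum_nonneg fun y _ => hV0 _
  have hTi : 0 ≤ T⁻¹ := inv_nonneg.2 hT.le
  nlinarith [mul_nonneg hTi hVs]

/-- The one-site weight `e^{-(p²/2 + U(q))/T}` is integrable on `ℝ × ℝ` when `T > 0`, `U` is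
measurable and `∫ e^{-U(q)/T} dq < ∞` (Gaussian in `p`). [folklore] -/
theorem integrable_siteWeight {T : ℝ} (hT : 0 < T)
    (hUi : Integrable (fun q : ℝ => Real.exp (-T⁻¹ * P.U q))) :
    Integrable (fun z : ℝ × ℝ => Real.exp (-T⁻¹ * (z.2 ^ 2 / 2 + P.U z.1))) := by
  have hgauss : Integrable (fun p : ℝ => Real.exp (-(T⁻¹ / 2) * p ^ 2)) :=
    integrable_exp_neg_mul_sq (by positivity)
  have hprod : Integrable (fun z : ℝ × ℝ =>
      Real.exp (-T⁻¹ * P.U z.1) * Real.exp (-(T⁻¹ / 2) * z.2 ^ 2))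
      ((volume : Measure ℝ).prod volume) := hUi.mul_prod hgauss
  rw [← Measure.volume_eq_prod] at hprod
  refine hprod.congr (Eventually.of_forall fun z => ?_)
  simp only
  rw [← Real.exp_add]
  congr 1
  ring

/-- **The normaliser is finite**: for `T > 0`, `V ≥ 0` and `∫ e^{-U(q)/T} dq < ∞`, `(∫⋯∫⁻_Λ e^{-H_Λ/T})(η) < ∞` for every `Λ` and `η` (LLL 1977, §4,
condition B2 for such chains). [cite: LanfordLebowitzLieb1977, §4 condition B2] -/
theorem lmarginal_boltzmann_lt_top {T : ℝ} (hT : 0 < T)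
    (hV0 : ∀ r, 0 ≤ P.V r) (hUi : Integrable (fun q : ℝ => Real.exp (-T⁻¹ * P.U q)))
    (Λ : Finset ℤ) (η : ChainConfig) :
    (∫⋯∫⁻_Λ, (fun σ =>
        ENNReal.ofReal (Real.exp (-T⁻¹ * hamiltonianIn P.chainPotential chainSupp Λ σ)))
      ∂fun _ : ℤ => (volume : Measure (ℝ × ℝ))) η < ∞ := by
  -- compare with the product of one-site weights, whose marginal integral is finite
  set φ : ℝ × ℝ → ℝ := fun z => Real.exp (-T⁻¹ * (z.2 ^ 2 / 2 + P.U z.1)) with hφ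
  have hφi : Integrable φ := P.integrable_siteWeight hT hUi
  calc (∫⋯∫⁻_Λ, (fun σ =>
          ENNReal.ofReal (Real.exp (-T⁻¹ * hamiltonianIn P.chainPotential chainSupp Λ σ)))
        ∂fun _ : ℤ => (volume : Measure (ℝ × ℝ))) η
      ≤ (∫⋯∫⁻_Λ, (fun σ => ∏ x ∈ Λ, ENNReal.ofReal (φ (σ x)))
          ∂fun _ : ℤ => (volume : Measure (ℝ × ℝ))) η :=
        lmarginal_mono (fun σ => P.boltzmannWeight_le_prod hT hV0 Λ σ) η
    _ = ∫⁻ ζ : Λ → ℝ × ℝ, ∏ i : Λ, ENNReal.ofReal (φ (ζ i))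
          ∂Measure.pi fun _ : Λ => (volume : Measure (ℝ × ℝ)) := by
        unfold lmarginal
        refine lintegral_congr fun ζ => ?_
        show ∏ x ∈ Λ, ENNReal.ofReal (φ (Function.updateFinset η Λ ζ x)) = _
        rw [← Finset.prod_coe_sort Λ]
        refine Finset.prod_congr rfl fun i _ => ?_
        rw [Function.updateFinset_def]
        simp only [dif_pos i.2]
    _ = ∫⁻ ζ : Λ → ℝ × ℝ, ENNReal.ofReal (∏ i : Λ, φ (ζ i))
          ∂Measure.pi fun _ : Λ => (volume : Measure (ℝ × ℝ)) := by
        refine lintegral_congr fun ζ => ?_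
        rw [ENNReal.ofReal_prod_of_nonneg fun i _ => (Real.exp_pos _).le]
    _ < ∞ := by
        have hI : Integrable (fun ζ : Λ → ℝ × ℝ => ∏ i : Λ, φ (ζ i))
            (Measure.pi fun _ : Λ => (volume : Measure (ℝ × ℝ))) :=
          Integrable.fintype_prod (f := fun _ : Λ => φ) fun _ => hφi
        exact (hasFiniteIntegral_iff_ofReal (Eventually.of_forall fun ζ =>
          Finset.prod_nonneg fun i _ => (Real.exp_pos _).le)).1 hI.hasFiniteIntegral

/-- **The normaliser is positive**: `0 < (∫⋯∫⁻_Λ e^{-H_Λ/T})(η)` (the weight is everywhere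
positive and Lebesgue measure is not zero). [folklore] -/
theorem lmarginal_boltzmann_pos (hU : Measurable P.U) (hV : Measurable P.V) (T : ℝ)
    (Λ : Finset ℤ) (η : ChainConfig) :
    0 < (∫⋯∫⁻_Λ, (fun σ =>
        ENNReal.ofReal (Real.exp (-T⁻¹ * hamiltonianIn P.chainPotential chainSupp Λ σ)))
      ∂fun _ : ℤ => (volume : Measure (ℝ × ℝ))) η := by
  unfold lmarginal
  have hmeas : Measurable fun ζ : Λ → ℝ × ℝ => ENNReal.ofReal (Real.exp (-T⁻¹ *
      hamiltonianIn P.chainPotential chainSupp Λ (Function.updateFinset η Λ ζ))) :=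
    (P.measurable_boltzmannWeight hU hV T Λ).comp measurable_updateFinset
  have hsupp : support (fun ζ : Λ → ℝ × ℝ => ENNReal.ofReal (Real.exp (-T⁻¹ *
      hamiltonianIn P.chainPotential chainSupp Λ (Function.updateFinset η Λ ζ)))) = univ :=
    eq_univ_of_forall fun ζ => (ENNReal.ofReal_pos.2 (Real.exp_pos _)).ne'
  have h := (lintegral_pos_iff_support (μ := Measure.pi fun _ : Λ => (volume : Measure (ℝ × ℝ)))
    hmeas).2 (by
      rw [hsupp, Measure.pi_univ]
      refine pos_iff_ne_zero.2 (Finset.prod_ne_zero_iff.2 fun i _ => ?_)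
      exact (isOpen_univ.measure_pos (volume : Measure (ℝ × ℝ)) univ_nonempty).ne')
  exact h

/-- The Boltzmann factor of the harmonic-plus-quartic pinning is integrable:
`∫ e^{-(ω₂ q²/2 + lam q⁴/4)/T} dq < ∞` for `T > 0`, `ω₂ > 0`, `lam ≥ 0` (Gaussian domination).
[folklore] -/
theorem integrable_exp_neg_pinning {T ω₂ lam : ℝ} (hT : 0 < T) (hω : 0 < ω₂) (hl : 0 ≤ lam)
    (β γ : ℝ) :
    Integrable (fun q : ℝ => Real.exp (-T⁻¹ * (pinnedChain ω₂ lam β γ).U q)) := by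
  have hgauss : Integrable (fun q : ℝ => Real.exp (-(T⁻¹ * ω₂ / 2) * q ^ 2)) :=
    integrable_exp_neg_mul_sq (by positivity)
  have hmeas : Measurable fun q : ℝ => ω₂ * q ^ 2 / 2 + lam * q ^ 4 / 4 := by fun_prop
  refine hgauss.mono' (Real.measurable_exp.comp (hmeas.const_mul _)).aestronglyMeasurable
    (Eventually.of_forall fun q => ?_)
  rw [Real.norm_eq_abs, abs_of_pos (Real.exp_pos _)]
  refine Real.exp_le_exp.2 ?_
  show -T⁻¹ * (ω₂ * q ^ 2 / 2 + lam * q ^ 4 / 4) ≤ -(T⁻¹ * ω₂ / 2) * q ^ 2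
  have hTi : 0 < T⁻¹ := inv_pos.2 hT
  nlinarith [mul_nonneg (mul_nonneg hTi.le hl) (pow_nonneg (sq_nonneg q) 2), sq_nonneg q]

end OscillatorChain

end Literature.MathematicalPhysics.KineticTheory.HeatConduction
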